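import Summits.CriticalPhenomena.PercolationContinuityZ3.Theorems.PercNearOneGluingNoHeavyLowerTailSunflowerLinkedCurrency
import HarnessLib

/-!
# `NoHeavyLowerTail` (crux stmt-CriticalPhenomena-4575), abstract sunflower cubic: the FREE-`h` abstraction of the
# two-linked-systems problem — its statement, its proved hub–h case, and its REFUTATION

Support file (seats `prim-ineq-prove-1` gen 53 (statement, hub–h pair) and gen 54 (refutation); `--supports
stmt-CriticalPhenomena-4575`).  Memos: run/shared/lean/prim/prim-ineq-prove-1/FINDING-CHEBYSHEV-prove1-g53.md §4–§5,
FINDING-FREEH-prove1-g54.md §1–§2.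

* **`FreeHConj`** — gen 53's dimensionless abstraction of (RES0′) with a free `h`-cell: three one-coin budgets (`Ȳ`-face,
  `h`-cell, `H`-face), two links (`k ≥ g`, `h ≥ g`), the caps `ε_Y ≤ τ'`, `ε_g + ε_h ≤ 1 − τ'` and the parameter relation
  `ε_Y X κ ε_h ≤ c ε_g` (`c₀ ≥ τσ`).  A plain definition (NOT an open conjecture): it is false.
* **`not_freeHConj`** — an explicit three-petal counterexample (dwarf + hub + h-petal, all budgets and the parameter relation
  tight) exceeding the bound by 0.47 %.  Its pull-back to the section model violates the `k`-cell budget, which the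
  abstraction dropped; (RES0′) itself is not affected (memo g54 §2).
* **`hub_h_pair`, `freeH_hub_h_pair`** — the PROVED two-petal case {any petal, pure-`h` petal} (gen 53): convexity in the
  `h`-ratio; this is the one-parameter tight family of the zero-floor limit.  (The case without free `g`, every number of
  petals, is `…SunflowerLinkedCurrencyVoluntary.freeH_kappa_one`, gen 54.)
-/

noncomputable section

namespace Summit.CriticalPhenomena.PercolationContinuityZ3.Theorems.SunflowerPartition

namespace SafeCalc

namespace LinkedCurrency

open Finset

variable {κ : Type*}

/-- **The free-`h` two-linked-systems conjecture (dimensionless form).**  Data: `0 < τ' < 1`; floor masses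
`0 < ε_Y ≤ τ'`, `0 < ε_g`, `0 < ε_h` with `ε_g + ε_h ≤ 1 − τ'`; `0 < κ ≤ 1` (= `α₀₁/α₁₁`), `R ≥ 1` (= `1/α₁₁`), `X ≥ 1`
(= `1/b_Ȳ`); a link constant `ρ > 0` with `ρ (1−τ') ε_g = τ' (ε_g + κ ε_h)` (= `τ/(1−τ)` in the section relaxation); the ONE
parameter relation `(1 − ε_Y − ε_g − ε_h) ε_g ≥ ε_Y X κ ε_h` (= `c₀ ≥ τσ`).  Petals `j ∈ S`: `Ȳ`-face ratio `x_j ∈ [1, X]`,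
`g`-excess `m_j ≥ 0` with `ρ m_j ≤ ε_Y (x_j − 1)` (`k ≥ g`), `h`-ratio `r_j` with `κ(ε_g + m_j) ≤ ε_g r_j` (`h ≥ g`),
`1 ≤ r_j ≤ R`.  If the three budgets `∏ x_j ≤ X`, `∏ r_j ≤ R`,
`∏ (1 + (m_j + ε_h(r_j − 1))/(ε_g + ε_h)) ≤ 1 + (ε_g(R/κ − 1) + ε_h(R − 1))/(ε_g + ε_h)` hold, then
`∏ (1 + ε_Y(x_j − 1) + m_j + ε_h(r_j − 1)) ≤ 1 + ε_Y(X − 1) + ε_g(R/κ − 1) + ε_h(R − 1)`.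
Stated by gen 53 as a conjecture abstracting (RES0′) with a free top cell; it is FALSE (`not_freeHConj` below, gen 54): the
abstraction dropped the `k`-cell budget of the section model.  Kept as a definition because its proved special cases
(`freeH_hub_h_pair` here; `…LinkedCurrencyVoluntary.freeH_kappa_one` for `κ = 1`) and its refutation refer to it.
[gen 53 statement; refuted gen 54] -/
def FreeHConj : Prop :=
  ∀ (ι : Type) (S : Finset ι) (τ' εY εg εh kap R X ρ : ℝ) (x m r : ι → ℝ),
    0 < τ' → τ' < 1 → 0 < εY → εY ≤ τ' → 0 < εg → 0 < εh → εg + εh ≤ 1 - τ' → 0 < kap → kap ≤ 1 → 1 ≤ R → 1 ≤ X →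
    0 < ρ → ρ * ((1 - τ') * εg) = τ' * (εg + kap * εh) →
    εY * X * kap * εh ≤ (1 - εY - εg - εh) * εg →
    (∀ j ∈ S, 1 ≤ x j ∧ x j ≤ X) → (∀ j ∈ S, 0 ≤ m j) → (∀ j ∈ S, ρ * m j ≤ εY * (x j - 1)) →
    (∀ j ∈ S, kap * (εg + m j) ≤ εg * r j ∧ 1 ≤ r j ∧ r j ≤ R) →
    ∏ j ∈ S, x j ≤ X → ∏ j ∈ S, r j ≤ R →
    ∏ j ∈ S, (1 + (m j + εh * (r j - 1)) / (εg + εh)) ≤ 1 + (εg * (R / kap - 1) + εh * (R - 1)) / (εg + εh) →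
    ∏ j ∈ S, (1 + εY * (x j - 1) + m j + εh * (r j - 1)) ≤ 1 + εY * (X - 1) + εg * (R / kap - 1) + εh * (R - 1)

/-- **The hub–h pair (proved case of `FreeHConj`).**  One arbitrary petal (value at most `W + K/r₂`, where
`W = c + ε_Y X` and `K/r₂ = ε_H λ₀ R/r₂` bounds its `H`-part through the diagonal bound `y₁ ≤ λ₀ r₁` and `r₁ ≤ R/r₂`) and one
PURE-`h` petal (`1 + ε_h(r₂ − 1)`): the product `(W + K/r₂)(1 + ε_h(r₂ − 1))` is convex in `r₂`, equals `W + K` at `r₂ = 1`,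
and is below it at `r₂ = R` exactly when `ε_h W R ≤ (1 − ε_h) K` — which is what `c₀ ≥ τσ` supplies.  This is the whole
one-parameter tight family of the zero-floor limit (memo §1, §5a). [this work] -/
theorem hub_h_pair {W K εh R r₂ : ℝ} (hW : 0 ≤ W) (hεh0 : 0 ≤ εh) (hr1 : 1 ≤ r₂) (hrR : r₂ ≤ R)
    (hrel : εh * W * R ≤ (1 - εh) * K) :
    (W + K / r₂) * (1 + εh * (r₂ - 1)) ≤ W + K := by
  have hr0 : 0 < r₂ := by linarith
  have hid : (W + K / r₂) * (1 + εh * (r₂ - 1)) = W + K + (r₂ - 1) * (εh * W - (1 - εh) * K / r₂) := by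
    field_simp
    ring
  have h1 : 0 ≤ r₂ - 1 := by linarith
  have h2 : εh * W * r₂ ≤ (1 - εh) * K := by
    have := mul_le_mul_of_nonneg_left hrR (mul_nonneg hεh0 hW)
    linarith
  have h3 : εh * W - (1 - εh) * K / r₂ ≤ 0 := by
    rw [sub_nonpos, le_div_iff₀ hr0]
    linarith
  rw [hid]
  nlinarith [mul_nonneg h1 (neg_nonneg.2 h3)]

/-- The hub–h pair in the variables of `FreeHConj` (two petals, the second a pure `h`-petal: `x₂ = 1`, `m₂ = 0`), using only
`x₁ ≤ X`, the diagonal bound `κ(ε_g + m₁) ≤ ε_g r₁` (`g ≤ h`), `r₁ r₂ ≤ R` and the parameter relation. [this work] -/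
theorem freeH_hub_h_pair {εY εg εh kap R X x₁ m₁ r₁ r₂ : ℝ} (hεY : 0 < εY) (hεg : 0 < εg) (hεh : 0 < εh)
    (hε1 : εY + εg + εh ≤ 1) (hkap : 0 < kap) (hX : 1 ≤ X)
    (hrel : εY * X * kap * εh ≤ (1 - εY - εg - εh) * εg)
    (hx1X : x₁ ≤ X) (hmr : kap * (εg + m₁) ≤ εg * r₁)
    (hr2 : 1 ≤ r₂) (hr2R : r₂ ≤ R) (hbud : r₁ * r₂ ≤ R) :
    (1 + εY * (x₁ - 1) + m₁ + εh * (r₁ - 1)) * (1 + εh * (r₂ - 1)) ≤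
      1 + εY * (X - 1) + εg * (R / kap - 1) + εh * (R - 1) := by
  have hr20 : 0 < r₂ := by linarith
  have hR0 : 0 < R := by linarith
  -- diagonal bound: m₁ ≤ εg (r₁/kap - 1), and r₁ ≤ R / r₂
  have hm1' : m₁ ≤ εg / kap * r₁ - εg := by
    rw [le_sub_iff_add_le, div_mul_eq_mul_div, le_div_iff₀ hkap]
    linarith
  have hr1' : r₁ ≤ R / r₂ := by rw [le_div_iff₀ hr20]; linarith
  -- bound the first factor by W + K/r₂ with W = (1-εY-εg-εh) + εY X, K = (εg/kap + εh) R
  obtain ⟨W, hWdef⟩ : ∃ v : ℝ, v = (1 - εY - εg - εh) + εY * X := ⟨_, rfl⟩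
  obtain ⟨K, hKdef⟩ : ∃ v : ℝ, v = (εg / kap + εh) * R := ⟨_, rfl⟩
  have hc : 0 ≤ 1 - εY - εg - εh := by linarith
  have hW : 0 ≤ W := by rw [hWdef]; positivity
  have hcoef : 0 ≤ εg / kap + εh := by positivity
  have hfac1 : 1 + εY * (x₁ - 1) + m₁ + εh * (r₁ - 1) ≤ W + K / r₂ := by
    have h3 : m₁ + εh * (r₁ - 1) ≤ (εg / kap + εh) * r₁ - εg - εh := by linarith
    have h4 : (εg / kap + εh) * r₁ ≤ K / r₂ := by
      rw [hKdef, mul_div_assoc]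
      exact mul_le_mul_of_nonneg_left hr1' hcoef
    have h5 : εY * (x₁ - 1) ≤ εY * (X - 1) := mul_le_mul_of_nonneg_left (by linarith) hεY.le
    rw [hWdef]
    linarith
  have hfac2 : 0 ≤ 1 + εh * (r₂ - 1) := by nlinarith
  have hrelWK : εh * W * R ≤ (1 - εh) * K := by
    -- εh (c + εY X) ≤ (1 - εh)(εg/kap + εh), then multiply by R
    have h5 : εh * εY * X ≤ (1 - εY - εg - εh) * εg / kap := by
      rw [le_div_iff₀ hkap]; linarith
    have h7 : (1 - εY - εg - εh) ≤ 1 - εh := by linarith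
    have h8 : 0 ≤ εg / kap := by positivity
    have h6 : (1 - εY - εg - εh) * (εg / kap) ≤ (1 - εh) * (εg / kap) := mul_le_mul_of_nonneg_right h7 h8
    have h9 : εh * (1 - εY - εg - εh) ≤ (1 - εh) * εh := by nlinarith
    have key : εh * W ≤ (1 - εh) * (εg / kap + εh) := by
      rw [hWdef, mul_div_assoc] at *
      nlinarith
    rw [hKdef]
    have := mul_le_mul_of_nonneg_right key hR0.le
    nlinarith
  have hmain := hub_h_pair hW hεh.le hr2 hr2R hrelWK
  have htarget : W + K = 1 + εY * (X - 1) + εg * (R / kap - 1) + εh * (R - 1) := by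
    rw [hWdef, hKdef]; ring
  calc (1 + εY * (x₁ - 1) + m₁ + εh * (r₁ - 1)) * (1 + εh * (r₂ - 1))
      ≤ (W + K / r₂) * (1 + εh * (r₂ - 1)) := mul_le_mul_of_nonneg_right hfac1 hfac2
    _ ≤ W + K := hmain
    _ = _ := htarget

/-! ## `FreeHConj` is false: an explicit three-petal counterexample (gen 54) -/

/-- **Refutation of `FreeHConj`.**  Three petals — a "dwarf" `(x, m, r) = (409/196, 21/20, 1)` (free `g` raised to the
`h`-floor, `k ≥ g` link tight), a "hub" `(174930/409, 21/20, 1)` taking ALL the remaining `Ȳ`-budget, and a pure `h`-petal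
`(1, 0, 142/55)` — at `τ' = ε_Y = 1/50`, `ε_g = 7/10`, `ε_h = 1/40`, `κ = 2/5`, `ρ = 71/3430`, `X = 1785/2`, `R = 142/55`
satisfy every hypothesis (the `Ȳ`-face, the `h`-cell, the `H`-face and the parameter relation all with EQUALITY) while the
product of values `2871460741201/125972000000 ≈ 22.794` exceeds the bound `49913/2200 ≈ 22.688`.  Mechanism: splitting a dwarf
off the hub gains because the hub's value is not proportional to its `Ȳ`-usage; in the section model this configuration
violates the `k`-CELL budget (and the `{w = 1}` face), which the abstraction dropped — so the abstraction, not (RES0′), fails.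
[this work, gen 54] -/
theorem not_freeHConj : ¬ FreeHConj := by
  intro h
  have key := h (Fin 3) Finset.univ (1/50) (1/50) (7/10) (1/40) (2/5) (142/55) (1785/2) (71/3430)
    ![409/196, 174930/409, 1] ![21/20, 21/20, 0] ![1, 1, 142/55]
    (by norm_num) (by norm_num) (by norm_num) (by norm_num) (by norm_num) (by norm_num) (by norm_num)
    (by norm_num) (by norm_num) (by norm_num) (by norm_num) (by norm_num) (by norm_num) (by norm_num)
    (by intro j _; fin_cases j <;> norm_num)
    (by intro j _; fin_cases j <;> norm_num)
    (by intro j _; fin_cases j <;> norm_num)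
    (by intro j _; fin_cases j <;> norm_num)
    (by norm_num [Fin.prod_univ_three, Matrix.cons_val_zero, Matrix.cons_val_one, Matrix.cons_val_two,
      Matrix.head_cons, Matrix.tail_cons])
    (by norm_num [Fin.prod_univ_three, Matrix.cons_val_zero, Matrix.cons_val_one, Matrix.cons_val_two,
      Matrix.head_cons, Matrix.tail_cons])
    (by norm_num [Fin.prod_univ_three, Matrix.cons_val_zero, Matrix.cons_val_one, Matrix.cons_val_two,
      Matrix.head_cons, Matrix.tail_cons])
  norm_num [Fin.prod_univ_three, Matrix.cons_val_zero, Matrix.cons_val_one, Matrix.cons_val_two,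
      Matrix.head_cons, Matrix.tail_cons] at key

end LinkedCurrency

end SafeCalc

end Summit.CriticalPhenomena.PercolationContinuityZ3.Theorems.SunflowerPartition
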